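import Summits.CriticalPhenomena.SAWScalingLimit.Theorems.BoundaryClosureNegative_Lattice

/-!
# Negative knowledge on crux `BoundaryClosure` — the corridor refutation of `HexObservableLimit`, part 5: the discretised half-disc (strip profile, body, corridor, the finsets `Lam δ wc`), numerics of the profile, membership, descent inside the strip.

Support for `SAWDefectDecoherenceHexObservableLimitRefutation.lean` (item stmt-CriticalPhenomena-5420, the conclusion of
crux `BoundaryClosure`, stmt-CriticalPhenomena-8536). Everything proved. [folklore]
-/

noncomputable section

open Set Filter Topology
open Literature.Probability.RandomPlanarGeometry
open Literature.Probability.LatticeModels Literature.Probability.RandomPlanarGeometry.SAW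

namespace Summit.CriticalPhenomena.SAWScalingLimit.Theorems.BoundaryClosure.Negative

/-! ### The discretised half-disc: strip profile, body, corridor -/

/-- Row-order index of a face: `j = 2 x₀ + k`. [folklore] -/
def jOf (v : HexVertex) : ℤ := 2 * v.1 0 + (v.2 : ℕ)

/-- Row of a face: `r = x₁`. [folklore] -/
def rOf (v : HexVertex) : ℤ := v.1 1

/-- `jOf (fj j r) = j`. [folklore] -/
@[simp] theorem jOf_fj (j r : ℤ) : jOf (fj j r) = j := by
  unfold jOf
  rcases Int.emod_two_eq_zero_or_one j with hj | hj
  · rw [fj_snd_of_even hj, fj_fst_zero]; simp; omega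
  · rw [fj_snd_of_odd hj, fj_fst_zero]; simp; omega

/-- `rOf (fj j r) = r`. [folklore] -/
@[simp] theorem rOf_fj (j r : ℤ) : rOf (fj j r) = r := by simp [rOf]

/-- Every face is `fj (jOf v) (rOf v)`. [folklore] -/
theorem fj_jOf_rOf (v : HexVertex) : fj (jOf v) (rOf v) = v := (eq_fj v).symm

/-- The half-width of row `r` of the discretised unit half-disc at mesh `δ`:
`W δ r = √(δ⁻² - ¾ (r+1)²)`. [folklore] -/
def W (δ : ℝ) (r : ℤ) : ℝ := Real.sqrt (δ⁻¹ ^ 2 - 3 / 4 * ((r : ℝ) + 1) ^ 2)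

/-- Admissible rows: `r ≥ 0` and half-width at least `1`. [folklore] -/
def OKRow (δ : ℝ) : Set ℤ := fun r => 0 ≤ r ∧ 1 ≤ δ⁻¹ ^ 2 - 3 / 4 * ((r : ℝ) + 1) ^ 2

/-- The abscissa `(j + r + 1)/2` of the face `fj j r`. [folklore] -/
def reA (j r : ℤ) : ℝ := ((j : ℝ) + r + 1) / 2

/-- The strip profile: admissible row and `|abscissa| ≤ W` (pairs `(j, r)`). [folklore] -/
def Strip (δ : ℝ) : Set (ℤ × ℤ) := fun ⟨j, r⟩ => r ∈ OKRow δ ∧ |reA j r| ≤ W δ r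

/-- The junction cell index `X = ⌈1/(2δ)⌉`. [folklore] -/
def Xc (δ : ℝ) : ℤ := ⌈1 / (2 * δ)⌉

/-- The tip cell index `T = ⌊3/(4δ)⌋`. [folklore] -/
def Tc (δ : ℝ) : ℤ := ⌊3 / (4 * δ)⌋

/-- The body: the strip profile with the row-`0` and row-`1` faces right of cell `X` removed
(moat and stub). [folklore] -/
def Body (δ : ℝ) : Set (ℤ × ℤ) := fun ⟨j, r⟩ => (j, r) ∈ Strip δ ∧ (r ≤ 1 → j ≤ 2 * Xc δ + 1)

/-- The corridor: the row-`0` faces of the cells `X < x₀ ≤ T`. [folklore] -/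
def Corr (δ : ℝ) : Set (ℤ × ℤ) := fun ⟨j, r⟩ => r = 0 ∧ 2 * Xc δ + 2 ≤ j ∧ j ≤ 2 * Tc δ + 1

/-- The two vertex sets in coordinates: the body (`wc = false`) and body ∪ corridor (`wc = true`).
[folklore] -/
def LamSet (δ : ℝ) (wc : Bool) : Set (ℤ × ℤ) := fun ⟨j, r⟩ => (j, r) ∈ Body δ ∨ (wc = true ∧ (j, r) ∈ Corr δ)

/-- A box bound for the coordinates. [folklore] -/
def Bb (δ : ℝ) : ℤ := ⌈4 / δ⌉ + 2

/-- The finite box of faces with coordinates in `[-B, B]²`. [folklore] -/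
def box (δ : ℝ) : Finset HexVertex :=
  ((Finset.Icc (-Bb δ) (Bb δ)) ×ˢ (Finset.Icc (-Bb δ) (Bb δ))).image fun p => fj p.1 p.2

open Classical in
/-- The vertex sets as finsets. [folklore] -/
def Lam (δ : ℝ) (wc : Bool) : Finset HexVertex :=
  (box δ).filter fun v => (jOf v, rOf v) ∈ LamSet δ wc

/-! ### Numerics of the profile -/

section Numerics

variable {δ : ℝ} {r : ℤ}

/-- `W ≤ δ⁻¹`. [folklore] -/
theorem W_le_inv (hδ : 0 < δ) (r : ℤ) : W δ r ≤ δ⁻¹ := by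
  unfold W
  rw [Real.sqrt_le_left (by positivity)]
  nlinarith [sq_nonneg ((r : ℝ) + 1)]

/-- `W` is non-increasing on rows `≥ -1`. [folklore] -/
theorem W_anti {r r' : ℤ} (hr : -1 ≤ r) (h : r ≤ r') : W δ r' ≤ W δ r := by
  unfold W
  apply Real.sqrt_le_sqrt
  have : ((r : ℝ) + 1) ^ 2 ≤ ((r' : ℝ) + 1) ^ 2 := by
    have h1 : (0 : ℝ) ≤ r + 1 := by exact_mod_cast (by omega : (0 : ℤ) ≤ r + 1)
    have h2 : (r : ℝ) + 1 ≤ r' + 1 := by exact_mod_cast (by omega : r + 1 ≤ r' + 1)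
    nlinarith
  linarith

/-- Admissible rows have half-width at least `1`. [folklore] -/
theorem one_le_W (h : r ∈ OKRow δ) : 1 ≤ W δ r := by
  unfold W; rw [Real.le_sqrt' (by norm_num)]; simpa using h.2

/-- `|a| ≤ W δ r ↔ a² ≤ δ⁻² - ¾(r+1)²` on admissible rows. [folklore] -/
theorem abs_le_W_iff (h : r ∈ OKRow δ) (a : ℝ) :
    |a| ≤ W δ r ↔ a ^ 2 ≤ δ⁻¹ ^ 2 - 3 / 4 * ((r : ℝ) + 1) ^ 2 := by
  unfold W
  rw [← Real.sqrt_sq_eq_abs, Real.sqrt_le_sqrt_iff (by linarith [h.2] : (0:ℝ) ≤ _)]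

/-- The strip profile is an interval in `j`. [folklore] -/
theorem inStrip_of_between {j₁ j₂ j r : ℤ} (h₁ : (j₁, r) ∈ Strip δ) (h₂ : (j₂, r) ∈ Strip δ) (hl : j₁ ≤ j)
    (hu : j ≤ j₂) : (j, r) ∈ Strip δ := by
  refine ⟨h₁.1, ?_⟩
  have a₁ := h₁.2; have a₂ := h₂.2
  unfold reA at *
  rw [abs_le] at *
  have hl' : (j₁ : ℝ) ≤ j := by exact_mod_cast hl
  have hu' : (j : ℝ) ≤ j₂ := by exact_mod_cast hu
  constructor <;> linarith [a₁.1, a₂.2]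

/-- Bounds on `X = ⌈1/(2δ)⌉`. [folklore] -/
theorem Xc_bounds (δ : ℝ) : 1 / (2 * δ) ≤ (Xc δ : ℝ) ∧ (Xc δ : ℝ) < 1 / (2 * δ) + 1 :=
  ⟨Int.le_ceil _, Int.ceil_lt_add_one _⟩

/-- Bounds on `T = ⌊3/(4δ)⌋`. [folklore] -/
theorem Tc_bounds (δ : ℝ) : (Tc δ : ℝ) ≤ 3 / (4 * δ) ∧ 3 / (4 * δ) - 1 < (Tc δ : ℝ) :=
  ⟨Int.floor_le _, Int.sub_one_lt_floor _⟩

/-- `16 ≤ δ⁻¹` for `0 < δ ≤ 1/16`. [folklore] -/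
theorem sixteen_le_inv (hδ : 0 < δ) (hδ' : δ ≤ 1 / 16) : (16 : ℝ) ≤ δ⁻¹ := by
  rw [le_inv_comm₀ (by norm_num) hδ]; linarith

/-- `1/(2δ) = δ⁻¹/2`. [folklore] -/
theorem one_div_two_mul (δ : ℝ) : 1 / (2 * δ) = δ⁻¹ / 2 := by
  rw [one_div, mul_inv, ← div_eq_inv_mul]

/-- `3/(4δ) = 3 δ⁻¹/4`. [folklore] -/
theorem three_div_four_mul (δ : ℝ) : 3 / (4 * δ) = 3 * δ⁻¹ / 4 := by
  rw [div_mul_eq_div_div, div_right_comm, div_eq_mul_inv 3 δ]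

/-- For `δ ≤ 1/16`: `X + 2 ≤ T` (the corridor has at least two cells). [folklore] -/
theorem Xc_add_two_le_Tc (hδ : 0 < δ) (hδ' : δ ≤ 1 / 16) : Xc δ + 2 ≤ Tc δ := by
  have hX := (Xc_bounds δ).2
  have hT := (Tc_bounds δ).2
  have h16 := sixteen_le_inv hδ hδ'
  rw [one_div_two_mul] at hX; rw [three_div_four_mul] at hT
  have : (Xc δ : ℝ) + 2 < Tc δ + 1 := by linarith
  have : Xc δ + 2 < Tc δ + 1 := by exact_mod_cast this
  omega

/-- `0 < X`. [folklore] -/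
theorem Xc_pos (hδ : 0 < δ) : 0 < Xc δ := by
  have hX := (Xc_bounds δ).1
  have : (0 : ℝ) < 1 / (2 * δ) := by positivity
  have : (0 : ℝ) < Xc δ := by linarith
  exact_mod_cast this

/-- Rows `0, 1, 2` are admissible for `δ ≤ 1/16`. [folklore] -/
theorem rowOK_of_le_two (hδ : 0 < δ) (hδ' : δ ≤ 1 / 16) {r : ℤ} (h0 : 0 ≤ r) (h2 : r ≤ 2) :
    r ∈ OKRow δ := by
  refine ⟨h0, ?_⟩
  have h16 := sixteen_le_inv hδ hδ'
  have hr : ((r : ℝ) + 1) ^ 2 ≤ 9 := by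
    have : (r : ℝ) + 1 ≤ 3 := by exact_mod_cast (by omega : r + 1 ≤ 3)
    have : (0 : ℝ) ≤ r + 1 := by exact_mod_cast (by omega : (0:ℤ) ≤ r + 1)
    nlinarith
  nlinarith

/-- The key width estimate at the bottom rows: `T + 2 ≤ W δ r` for `r ≤ 2`, `δ ≤ 1/16`. [folklore] -/
theorem Tc_add_two_le_W (hδ : 0 < δ) (hδ' : δ ≤ 1 / 16) {r : ℤ} (h0 : 0 ≤ r) (h2 : r ≤ 2) :
    (Tc δ : ℝ) + 2 ≤ W δ r := by
  have hT := (Tc_bounds δ).1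
  have h16 := sixteen_le_inv hδ hδ'
  have hTpos : (0 : ℝ) ≤ Tc δ + 2 := by
    have := (Tc_bounds δ).2
    have : (0:ℝ) < 3 / (4 * δ) := by positivity
    linarith
  rw [← abs_of_nonneg hTpos, abs_le_W_iff (rowOK_of_le_two hδ hδ' h0 h2)]
  have hr : ((r : ℝ) + 1) ^ 2 ≤ 9 := by
    have : (r : ℝ) + 1 ≤ 3 := by exact_mod_cast (by omega : r + 1 ≤ 3)
    have : (0 : ℝ) ≤ r + 1 := by exact_mod_cast (by omega : (0:ℤ) ≤ r + 1)
    nlinarith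
  rw [three_div_four_mul] at hT
  nlinarith

end Numerics


/-! ### Reachability as a relation on plain vertices -/

/-- The pairs `(u, v)` of vertices of `S` joined by a path of `hexGraph` inside `S`. [folklore] -/
def RchRel (S : Set HexVertex) : Set (HexVertex × HexVertex) :=
  fun ⟨u, v⟩ => ∃ (hu : u ∈ S) (hv : v ∈ S), (hexGraph.induce S).Reachable ⟨u, hu⟩ ⟨v, hv⟩


section RchAPI

variable {S : Set HexVertex} {u v w : HexVertex}

/-- Reflexivity. [folklore] -/
theorem rch_rfl (hu : u ∈ S) : (u, u) ∈ RchRel S := ⟨hu, hu, SimpleGraph.Reachable.refl _⟩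

/-- Symmetry. [folklore] -/
theorem rch_symm (h : (u, v) ∈ RchRel S) : (v, u) ∈ RchRel S := by
  obtain ⟨hu, hv, p⟩ := h; exact ⟨hv, hu, p.symm⟩

/-- Transitivity. [folklore] -/
theorem rch_trans (h₁ : (u, v) ∈ RchRel S) (h₂ : (v, w) ∈ RchRel S) : (u, w) ∈ RchRel S := by
  obtain ⟨hu, hv, p⟩ := h₁; obtain ⟨hv', hw, q⟩ := h₂; exact ⟨hu, hw, p.trans q⟩

/-- One edge. [folklore] -/
theorem rch_of_adj (hu : u ∈ S) (hv : v ∈ S) (h : hexGraph.Adj u v) : (u, v) ∈ RchRel S :=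
  ⟨hu, hv, reach_of_adj S hu hv h⟩

end RchAPI

section RchPaths

variable (S : Set HexVertex)

/-- Row paths, `RchRel` form. [folklore] -/
theorem rch_row (r j₁ j₂ : ℤ) (hle : j₁ ≤ j₂) (h : ∀ i : ℤ, j₁ ≤ i → i ≤ j₂ → fj i r ∈ S) :
    (fj j₁ r, fj j₂ r) ∈ RchRel S :=
  ⟨_, _, reach_row' S r j₁ j₂ hle h⟩

/-- Row paths between two indices in either order. [folklore] -/
theorem rch_row_of_between (r j₁ j₂ : ℤ)
    (h : ∀ i : ℤ, min j₁ j₂ ≤ i → i ≤ max j₁ j₂ → fj i r ∈ S) : (fj j₁ r, fj j₂ r) ∈ RchRel S := by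
  rcases le_total j₁ j₂ with hle | hle
  · exact rch_row S r j₁ j₂ hle fun i hi hi' => h i (by rw [min_eq_left hle]; exact hi)
      (by rw [max_eq_right hle]; exact hi')
  · exact rch_symm (rch_row S r j₂ j₁ hle fun i hi hi' => h i (by rw [min_eq_right hle]; exact hi)
      (by rw [max_eq_left hle]; exact hi'))

/-- Downward double columns, `RchRel` form. [folklore] -/
theorem rch_col_down {j : ℤ} (hj : j % 2 = 0) (r : ℤ) (n : ℕ) (h0 : fj j r ∈ S)
    (h : ∀ i : ℤ, 1 ≤ i → i ≤ n → fj j (r - i) ∈ S ∧ fj (j + 1) (r - i) ∈ S) :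
    (fj j r, fj j (r - n)) ∈ RchRel S :=
  ⟨_, _, reach_col_down S hj r n h0 h⟩

/-- Upward double columns, `RchRel` form. [folklore] -/
theorem rch_col_up {j : ℤ} (hj : j % 2 = 1) (r : ℤ) (n : ℕ) (h0 : fj j r ∈ S)
    (h : ∀ i : ℤ, 1 ≤ i → i ≤ n → fj j (r + i) ∈ S ∧ fj (j - 1) (r + i) ∈ S) :
    (fj j r, fj j (r + n)) ∈ RchRel S :=
  ⟨_, _, reach_col_up S hj r n h0 h⟩

end RchPaths

/-! ### Membership in the vertex sets -/

section Membership

variable {δ : ℝ} {wc : Bool}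

/-- Admissible rows are at most `2δ⁻¹ - 1`. [folklore] -/
theorem row_le_of_rowOK (hδ : 0 < δ) {r : ℤ} (h : r ∈ OKRow δ) : (r : ℝ) + 1 ≤ 2 * δ⁻¹ := by
  have h1 := h.2
  have hr : (0 : ℝ) ≤ r + 1 := by exact_mod_cast (by linarith [h.1] : (0:ℤ) ≤ r + 1)
  have hi : (0 : ℝ) < δ⁻¹ := by positivity
  by_contra H
  push Not at H
  nlinarith

/-- The coordinates of a strip face are bounded by `4δ⁻¹` and `2δ⁻¹`. [folklore] -/
theorem bounds_of_inStrip (hδ : 0 < δ) {j r : ℤ} (h : (j, r) ∈ Strip δ) :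
    |(j : ℝ)| ≤ 4 * δ⁻¹ ∧ 0 ≤ r ∧ (r : ℝ) ≤ 2 * δ⁻¹ := by
  have hr := row_le_of_rowOK hδ h.1
  have hW := W_le_inv hδ r
  have ha := h.2
  unfold reA at ha
  rw [abs_le] at ha ⊢
  have h0 : (0 : ℝ) ≤ r := by exact_mod_cast h.1.1
  refine ⟨⟨by linarith [ha.1], by linarith [ha.2]⟩, h.1.1, by linarith⟩

/-- Faces of the vertex sets lie in the box. [folklore] -/
theorem fj_mem_box (hδ : 0 < δ) (hδ' : δ ≤ 1 / 16) {j r : ℤ} (h : (j, r) ∈ LamSet δ wc) :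
    fj j r ∈ box δ := by
  have hB : 4 * δ⁻¹ + 2 ≤ (Bb δ : ℝ) := by
    have h1 : (4 / δ : ℝ) ≤ ⌈4 / δ⌉ := Int.le_ceil (4 / δ)
    have e : (4 / δ : ℝ) = 4 * δ⁻¹ := div_eq_mul_inv _ _
    unfold Bb; push_cast; linarith
  have hi : (0 : ℝ) < δ⁻¹ := by positivity
  have key : |(j : ℝ)| ≤ 4 * δ⁻¹ + 2 ∧ |(r : ℝ)| ≤ 4 * δ⁻¹ + 2 := by
    rcases h with h | ⟨-, h⟩
    · obtain ⟨hj, h0, hr⟩ := bounds_of_inStrip hδ h.1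
      refine ⟨by linarith, ?_⟩
      rw [abs_of_nonneg (by exact_mod_cast h0)]; linarith
    · obtain ⟨rfl, h1, h2⟩ := h
      have hT := (Tc_bounds δ).1
      have hX := Xc_pos hδ
      rw [three_div_four_mul] at hT
      have h2' : (j : ℝ) ≤ 2 * Tc δ + 1 := by exact_mod_cast h2
      have h1' : (0 : ℝ) ≤ j := by exact_mod_cast (by omega : (0:ℤ) ≤ j)
      refine ⟨?_, by simp; positivity⟩
      rw [abs_of_nonneg h1']; linarith
  have key' : -Bb δ ≤ j ∧ j ≤ Bb δ ∧ -Bb δ ≤ r ∧ r ≤ Bb δ := by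
    obtain ⟨hj, hr⟩ := key
    rw [abs_le] at hj hr
    refine ⟨?_, ?_, ?_, ?_⟩ <;>
    · have : (-(Bb δ : ℝ) ≤ j ∧ (j : ℝ) ≤ Bb δ) ∧ (-(Bb δ : ℝ) ≤ r ∧ (r : ℝ) ≤ Bb δ) :=
        ⟨⟨by linarith, by linarith⟩, ⟨by linarith, by linarith⟩⟩
      first
      | exact_mod_cast this.1.1 | exact_mod_cast this.1.2
      | exact_mod_cast this.2.1 | exact_mod_cast this.2.2
  unfold box
  rw [Finset.mem_image]
  exact ⟨(j, r), by simp only [Finset.mem_product, Finset.mem_Icc]; omega, rfl⟩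

/-- **Membership in the vertex sets is the coordinate predicate.** [folklore] -/
theorem fj_mem_Lam_iff (hδ : 0 < δ) (hδ' : δ ≤ 1 / 16) {j r : ℤ} :
    fj j r ∈ Lam δ wc ↔ (j, r) ∈ LamSet δ wc := by
  classical
  simp only [Lam, Finset.mem_filter, jOf_fj, rOf_fj]
  exact ⟨fun h => h.2, fun h => ⟨fj_mem_box hδ hδ' h, h⟩⟩

/-- Membership in the coerced set. [folklore] -/
theorem fj_mem_coe_iff (hδ : 0 < δ) (hδ' : δ ≤ 1 / 16) {j r : ℤ} :
    fj j r ∈ ((Lam δ wc : Finset HexVertex) : Set HexVertex) ↔ (j, r) ∈ LamSet δ wc := by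
  rw [Finset.mem_coe, fj_mem_Lam_iff hδ hδ']

/-- Membership in the complement. [folklore] -/
theorem fj_mem_compl_iff (hδ : 0 < δ) (hδ' : δ ≤ 1 / 16) {j r : ℤ} :
    fj j r ∈ ((Lam δ wc : Finset HexVertex) : Set HexVertex)ᶜ ↔ ¬ (j, r) ∈ LamSet δ wc := by
  rw [Set.mem_compl_iff, fj_mem_coe_iff hδ hδ']

end Membership

/-! ### Descent inside the strip -/

section Descent

variable {δ : ℝ}

/-- **Vertical descent**: below an up triangle of the strip (row `≥ 1`) the down triangle is in the
strip (same abscissa, wider row). [folklore] -/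
theorem inStrip_down {j r : ℤ} (hr : 1 ≤ r) (h : (j, r) ∈ Strip δ) : (j + 1, r - 1) ∈ Strip δ := by
  obtain ⟨⟨h0, h1⟩, h2⟩ := h
  refine ⟨⟨by omega, ?_⟩, ?_⟩
  · push_cast
    have : (0:ℝ) ≤ r := by exact_mod_cast (by omega : (0:ℤ) ≤ r)
    nlinarith
  · have e : reA (j + 1) (r - 1) = reA j r := by unfold reA; push_cast; ring
    rw [e]
    exact h2.trans (W_anti (by omega) (by omega))

/-- **Sideways step**: one of the two row-neighbours of a strip face is in the strip (the inward
one). [folklore] -/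
theorem inStrip_side {j r : ℤ} (h : (j, r) ∈ Strip δ) : (j - 1, r) ∈ Strip δ ∨ (j + 1, r) ∈ Strip δ := by
  have hW := one_le_W h.1
  have ha := h.2
  rw [abs_le] at ha
  by_cases hs : 0 ≤ reA j r
  · left
    refine ⟨h.1, ?_⟩
    have e : reA (j - 1) r = reA j r - 1 / 2 := by unfold reA; push_cast; ring
    rw [e, abs_le]; constructor <;> linarith
  · right
    refine ⟨h.1, ?_⟩
    have e : reA (j + 1) r = reA j r + 1 / 2 := by unfold reA; push_cast; ring
    rw [e, abs_le]; push Not at hs; constructor <;> linarith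

/-- Small abscissae are in the strip of the bottom rows: `|j + r + 1| ≤ 2T + 4`, `r ≤ 2`. [folklore] -/
theorem inStrip_of_small (hδ : 0 < δ) (hδ' : δ ≤ 1 / 16) {j r : ℤ} (h0 : 0 ≤ r) (h2 : r ≤ 2)
    (hj : |j + r + 1| ≤ 2 * Tc δ + 4) : (j, r) ∈ Strip δ := by
  refine ⟨rowOK_of_le_two hδ hδ' h0 h2, ?_⟩
  have hW := Tc_add_two_le_W hδ hδ' h0 h2
  have : |reA j r| ≤ (Tc δ : ℝ) + 2 := by
    unfold reA
    rw [abs_div, abs_two, div_le_iff₀ (by norm_num : (0:ℝ) < 2)]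
    have : (|j + r + 1| : ℝ) ≤ 2 * Tc δ + 4 := by exact_mod_cast hj
    linarith
  exact this.trans hW

end Descent



end Summit.CriticalPhenomena.SAWScalingLimit.Theorems.BoundaryClosure.Negative
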